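import Literature.NumberTheory.GaloisRepresentations.NearlyOrdinaryPresentationLifts
import Literature.NumberTheory.GaloisRepresentations.AdjointCoefficients
import Literature.NumberTheory.GaloisRepresentations.DeformationLiftingObstruction
import HarnessLib

/-!
# Residue-field coefficients for the cone obstruction: `κ = 𝒪⟦T⟧/𝔪`

Topic `Literature/NumberTheory/GaloisRepresentations`.  For a presentation `Θ : 𝒪⟦T⟧ ↠ R_𝒟`
(more generally a surjection `Θ : P ↠ R` of local `𝒪`-algebras) the residue fields agree,
`P/𝔪_P ≃ R/𝔪_R` (`residueEquiv`), and every truncation `R/𝔪ⁿ` (`n ≥ 1`) reduces to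
`κ = P/𝔪_P` (`resA`).  Through `resA` the reductions `ρ_𝒟 mod 𝔪ⁿ` (on `G_{F,S}`) and
`localModPow v n` (on `Γ_{F_v}`, upper triangular for `v ∣ p`) give the RESIDUAL representations
with coefficients in `κ` (`residualK`, `localResidualK`: open kernels, Borel values at `v ∣ p`),
whose adjoint representations `ad`, `𝔟_v` (`LiftingObstruction.adRep`, `adParabolicRep`) are the
coefficient objects of the cone obstruction map in Mazur's relation count for `R_𝒟`
(Böckle 2007, Thm. 7.6; the choice `κ = 𝒪⟦T⟧/𝔪` makes the obstruction map linear over the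
residue field of the presentation, as required by `nearlyOrdinaryPresentation_of_obstruction`).
Everything is proved; no named facts.

## References

* G. Böckle, *Presentations of universal deformation rings*, LMS LNS 320 (2007), Thm. 2.4,
  Thm. 7.6. [cite: Bockle2007Presentations, Theorem 7.6]
* B. Mazur, *Deforming Galois representations*, MSRI Publ. 16 (1989), §1.6 Prop. 2.
  [cite: Mazur1989Deforming, §1.6 Prop. 2]
-/

noncomputable section

open scoped NumberField
open Field IsDedekindDomain IsLocalRing

namespace Literature.NumberTheory.GaloisRepresentations

namespace NearlyOrdinaryPresentationCA

/-! ## 1. `P/𝔪_P ≃ R/𝔪_R` and the reduction `R/𝔪ⁿ → P/𝔪_P` -/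

section Residue

variable {𝒪 : Type*} [CommRing 𝒪] {P R : Type*} [CommRing P] [CommRing R] [IsLocalRing P]
  [IsLocalRing R] [Algebra 𝒪 P] [Algebra 𝒪 R] (Θ : P →ₐ[𝒪] R) (hΘ : Function.Surjective Θ)

/-- `ker Θ + 𝔪_P¹ = 𝔪_P`. [folklore] -/
theorem ker_sup_pow_one_eq : RingHom.ker Θ ⊔ maximalIdeal P ^ 1 = maximalIdeal P := by
  rw [pow_one]
  exact sup_eq_right.mpr (IsLocalRing.le_maximalIdeal (RingHom.ker_ne_top _))

/-- **The residue fields of `P` and `R` agree**: `P/𝔪_P ≃ₐ[𝒪] R/𝔪_R` for a surjection of local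
`𝒪`-algebras. [folklore] -/
def residueEquiv : (P ⧸ maximalIdeal P) ≃ₐ[𝒪] R ⧸ maximalIdeal R :=
  ((Ideal.quotientEquivAlgOfEq 𝒪 (ker_sup_pow_one_eq Θ).symm).trans (truncEquiv Θ hΘ 1)).trans
    (Ideal.quotientEquivAlgOfEq 𝒪 (pow_one (maximalIdeal R)))

/-- `residueEquiv` on residue classes. [folklore] -/
@[simp] theorem residueEquiv_mk (x : P) :
    residueEquiv Θ hΘ (Ideal.Quotient.mk (maximalIdeal P) x) =
      Ideal.Quotient.mk (maximalIdeal R) (Θ x) := by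
  simp [residueEquiv]

/-- **The reduction `R/𝔪_Rⁿ → P/𝔪_P`** (`n ≠ 0`). [folklore] -/
def resA (n : ℕ) (hn0 : n ≠ 0) : (R ⧸ maximalIdeal R ^ n) →+* P ⧸ maximalIdeal P :=
  ((residueEquiv Θ hΘ).symm : (R ⧸ maximalIdeal R) →ₐ[𝒪] P ⧸ maximalIdeal P).toRingHom.comp
    (Ideal.Quotient.factor (Ideal.pow_le_self hn0))

/-- `resA (Θ x mod 𝔪ⁿ) = x mod 𝔪_P`. [folklore] -/
@[simp] theorem resA_mk_apply (n : ℕ) (hn0 : n ≠ 0) (x : P) :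
    resA Θ hΘ n hn0 (Ideal.Quotient.mk (maximalIdeal R ^ n) (Θ x)) =
      Ideal.Quotient.mk (maximalIdeal P) x := by
  change (residueEquiv Θ hΘ).symm (Ideal.Quotient.factor (Ideal.pow_le_self hn0)
    (Ideal.Quotient.mk (maximalIdeal R ^ n) (Θ x))) = _
  rw [Ideal.Quotient.factor_mk, AlgEquiv.symm_apply_eq, residueEquiv_mk]

/-- `resA ∘ (P → R/𝔪ⁿ) = (P → P/𝔪_P)`. [folklore] -/
theorem resA_comp_truncMap (n : ℕ) (hn0 : n ≠ 0) :
    (resA Θ hΘ n hn0).comp (truncMap Θ n : P →+* R ⧸ maximalIdeal R ^ n) =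
      Ideal.Quotient.mk (maximalIdeal P) :=
  RingHom.ext fun x => by
    rw [RingHom.comp_apply]
    exact resA_mk_apply Θ hΘ n hn0 x

end Residue

/-! ## 2. The residual representations with coefficients in `κ = 𝒪⟦T⟧/𝔪` -/

section Residual

variable {F : Type} [Field F] [NumberField F] {p : ℕ} {𝒪 : Type} [CommRing 𝒪] [IsLocalRing 𝒪]
  {k : Type} [Field k] [Algebra 𝒪 k] {𝒟 : NearlyOrdinaryDatum F p 𝒪 k}
  (𝓡 : NearlyOrdinaryDeformationRing.{0} 𝒟)
  {m : ℕ} (Θ : MvPowerSeries (Fin m) 𝒪 →ₐ[𝒪] 𝓡.R) (hΘ : Function.Surjective Θ)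
  (n : ℕ) (hn0 : n ≠ 0)

/-- **The residual representation of `G_{F,S}` with coefficients in `κ = 𝒪⟦T⟧/𝔪`**:
`resA ∘ (ρ_𝒟 mod 𝔪ⁿ)`. [cite: Bockle2007Presentations, Theorem 7.6] -/
def residualK : GaloisGroupUnramifiedOutside F 𝒟.S →*
    GL (Fin 2) (MvPowerSeries (Fin m) 𝒪 ⧸ maximalIdeal (MvPowerSeries (Fin m) 𝒪)) :=
  (Matrix.GeneralLinearGroup.map (resA Θ hΘ n hn0)).comp (𝓡.modPowQuot n)

/-- Unfolding `residualK`. [folklore] -/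
@[simp] theorem residualK_apply (σ : GaloisGroupUnramifiedOutside F 𝒟.S) :
    residualK 𝓡 Θ hΘ n hn0 σ = Matrix.GeneralLinearGroup.map (resA Θ hΘ n hn0) (𝓡.modPowQuot n σ) :=
  rfl

/-- `residualK` has open kernel. [cite: Mazur1997Deformation, §2] -/
theorem isOpen_ker_residualK :
    IsOpen (((residualK 𝓡 Θ hΘ n hn0).ker : Subgroup (GaloisGroupUnramifiedOutside F 𝒟.S)) :
      Set (GaloisGroupUnramifiedOutside F 𝒟.S)) := by
  refine Subgroup.isOpen_mono ?_ (𝓡.isOpen_ker_modPowQuot n)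
  intro σ hσ
  rw [MonoidHom.mem_ker] at hσ ⊢
  rw [residualK_apply, hσ, map_one]

/-- **The local residual representation at `v` with coefficients in `κ`** (in the nearly
ordinary frame): `resA ∘ localModPow v n`. [cite: Bockle2007Presentations, Theorem 7.6] -/
def localResidualK (v : HeightOneSpectrum (𝓞 F)) :
    absoluteGaloisGroup (v.adicCompletion F) →*
      GL (Fin 2) (MvPowerSeries (Fin m) 𝒪 ⧸ maximalIdeal (MvPowerSeries (Fin m) 𝒪)) :=
  (Matrix.GeneralLinearGroup.map (resA Θ hΘ n hn0)).comp (𝓡.localModPow v n)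

/-- Unfolding `localResidualK`. [folklore] -/
@[simp] theorem localResidualK_apply (v : HeightOneSpectrum (𝓞 F))
    (σ : absoluteGaloisGroup (v.adicCompletion F)) :
    localResidualK 𝓡 Θ hΘ n hn0 v σ =
      Matrix.GeneralLinearGroup.map (resA Θ hΘ n hn0) (𝓡.localModPow v n σ) :=
  rfl

/-- `localResidualK v` has open kernel. [cite: Mazur1997Deformation, §2] -/
theorem isOpen_ker_localResidualK (v : HeightOneSpectrum (𝓞 F)) :
    IsOpen (((localResidualK 𝓡 Θ hΘ n hn0 v).ker :
      Subgroup (absoluteGaloisGroup (v.adicCompletion F))) :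
        Set (absoluteGaloisGroup (v.adicCompletion F))) := by
  refine Subgroup.isOpen_mono ?_ (𝓡.isOpen_ker_localModPow v n)
  intro σ hσ
  rw [MonoidHom.mem_ker] at hσ ⊢
  rw [localResidualK_apply, hσ, map_one]

/-- `localResidualK v` is upper triangular for `v ∣ p`. [cite: Bockle2007Presentations, Theorem 7.6] -/
theorem localResidualK_mem_borel (v : HeightOneSpectrum (𝓞 F)) (hv : (p : 𝓞 F) ∈ v.asIdeal)
    (σ : absoluteGaloisGroup (v.adicCompletion F)) :
    localResidualK 𝓡 Θ hΘ n hn0 v σ ∈ LiftingObstruction.parabolicGL (id : Fin 2 → Fin 2)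
      (MvPowerSeries (Fin m) 𝒪 ⧸ maximalIdeal (MvPowerSeries (Fin m) 𝒪)) :=
  LiftingObstruction.map_mem_parabolicGL _ (𝓡.localModPow_mem_borel v hv n σ)

/-- Every representation is `P_b`-valued for a CONSTANT pattern (the unrestricted case).
[folklore] -/
theorem mem_parabolicGL_const {ι : Type*} [Fintype ι] [DecidableEq ι] {S : Type*} [CommRing S]
    {β : Type*} [LinearOrder β] (a : β) (g : GL ι S) :
    g ∈ LiftingObstruction.parabolicGL (fun _ : ι => a) S :=
  LiftingObstruction.blockTriangular_const _ a

end Residual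

end NearlyOrdinaryPresentationCA

end Literature.NumberTheory.GaloisRepresentations
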